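import Literature.Probability.Process.BrownianSkeleton
import Literature.Probability.Process.BrownianSmallBall
import HarnessLib

/-!
# The law of the Brownian skeleton is bounded below by Lebesgue measure on balls; small remainders

Probability/Process support file (serves the provefact unit of
`Literature.MathematicalPhysics.KineticTheory.HeatConduction.CuneoEckmannHairerReyBellet2018_thm213`:
the Hörmander-free local minorisation of the pinned chain, which conditions on the Brownian
bridges and uses the dyadic skeleton of `BrownianSkeleton.lean` as a finite-dimensional Gaussian
parameter). Everything here is PROVED; no named facts.

* `Measure.pi_le_pi_fin` — `Measure.pi` over `Fin n` is MONOTONE in its factors (induction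
  through `measurePreserving_piFinSuccAbove` and Mathlib's `prod_mono`).
* `gaussianReal_ge_smul_restrict` — a centred real Gaussian dominates `c · Leb|_{[-R,R]}` with
  `c = pdf(R) > 0`.
* `map_dyadicIncr_brownian_eq_pi` — the law of the dyadic skeleton of level `m` of the canonical
  Brownian motion IS the product of the Gaussian laws `N(0, |t_{i+1}-t_i|)` of the increments;
  `exists_map_dyadicIncr_ge`, `exists_wienerPair_map_pairSkel_ge` — hence it (and the law of the
  skeleton of the pair) dominates `c · Leb` on the sup-norm ball of radius `R`, for every `R`.
* `abs_bridgeRem_le` — the remainder is controlled by the path on `[0,1]`: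
  `sup_{u ≤ 1} |R^m w(u)| ≤ (1 + 2·2ᵐ) sup_{u ≤ 1} |w(u)|` (tent coefficients lie in `[0,1]`);
  `abs_pairRem_le_of_mem_goodEvent`, `wienerPair_goodEvent_pos` — so the remainders of the pair are
  small on the (measurable, positive-probability) good event of `BrownianSupTail.lean`.

## References

* D. Revuz, M. Yor, *Continuous Martingales and Brownian Motion* (1999), Ch. I §1 (Brownian
  finite-dimensional laws); P. Lévy (1948) (bridge decomposition). [folklore]
-/

noncomputable section

open MeasureTheory ProbabilityTheory Finset Set
open scoped NNReal ENNReal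

namespace Literature.Probability.Process

open KolmogorovChentsov (dyad coe_dyad)

universe u

/-! ### Monotonicity of finite product measures -/

/-- **`Measure.pi` over `Fin n` is monotone in its factors.** [folklore] -/
theorem Measure.pi_le_pi_fin {n : ℕ} {α : Fin n → Type u} [∀ i, MeasurableSpace (α i)]
    (μ ν : ∀ i, Measure (α i)) [∀ i, SigmaFinite (μ i)] [∀ i, SigmaFinite (ν i)]
    (h : ∀ i, μ i ≤ ν i) : Measure.pi μ ≤ Measure.pi ν := by
  induction n with
  | zero =>
    rw [Measure.pi_of_empty μ, Measure.pi_of_empty ν]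
  | succ n ih =>
    set e := MeasurableEquiv.piFinSuccAbove α 0 with he
    have hμ := (measurePreserving_piFinSuccAbove μ 0).symm e
    have hν := (measurePreserving_piFinSuccAbove ν 0).symm e
    rw [← hμ.map_eq, ← hν.map_eq]
    refine Measure.map_mono ?_ e.symm.measurable
    exact Measure.prod_mono (h 0) (ih (fun j => μ (Fin.succAbove 0 j)) (fun j => ν (Fin.succAbove 0 j))
      fun j => h _)

/-- The product of constant multiples of restricted Lebesgue measures over `Fin n`:
`⨂ (c • λ|_S) = cⁿ • (⨂ λ)|_{Sⁿ}`. [folklore] -/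
theorem Measure.pi_const_smul_restrict {n : ℕ} (c : ℝ≥0) (S : Set ℝ) :
    Measure.pi (fun _ : Fin n => c • (volume : Measure ℝ).restrict S) =
      (c : ℝ≥0∞) ^ n • (volume : Measure (Fin n → ℝ)).restrict (Set.univ.pi fun _ => S) := by
  refine Measure.pi_eq fun s hs => ?_
  rw [Measure.smul_apply, Measure.restrict_apply (MeasurableSet.univ_pi hs), ← Set.pi_inter_distrib,
    volume_pi_pi, smul_eq_mul]
  simp only [Measure.coe_nnreal_smul_apply, Measure.restrict_apply (hs _)]
  rw [prod_mul_distrib, prod_const, card_univ, Fintype.card_fin]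

/-! ### A centred Gaussian dominates Lebesgue measure on bounded intervals -/

/-- The Gaussian density decreases in `|x|`: `pdf(x) ≥ pdf(R)` for `|x| ≤ R` (`μ = 0`).
[folklore] -/
theorem gaussianPDFReal_ge_of_abs_le (v : ℝ≥0) {R x : ℝ} (hx : |x| ≤ R) :
    gaussianPDFReal 0 v R ≤ gaussianPDFReal 0 v x := by
  rw [gaussianPDFReal, gaussianPDFReal]
  refine mul_le_mul_of_nonneg_left ?_ (by positivity)
  refine Real.exp_le_exp.2 ?_
  rw [sub_zero, sub_zero]
  have hx2 : x ^ 2 ≤ R ^ 2 := by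
    have h1 : x ^ 2 = |x| ^ 2 := (sq_abs x).symm
    rw [h1]
    exact pow_le_pow_left₀ (abs_nonneg x) hx 2
  have hv : (0 : ℝ) ≤ 2 * v := by positivity
  rw [neg_div, neg_div, neg_le_neg_iff]
  exact div_le_div_of_nonneg_right hx2 hv

/-- **A centred real Gaussian dominates a multiple of Lebesgue measure on `[-R, R]`**:
`N(0, v) ≥ pdf(R) · Leb|_{[-R,R]}` (`v ≠ 0`). [folklore] -/
theorem gaussianReal_ge_smul_restrict {v : ℝ≥0} (hv : v ≠ 0) (R : ℝ) :
    (gaussianPDFReal 0 v R).toNNReal • (volume : Measure ℝ).restrict (Icc (-R) R) ≤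
      gaussianReal 0 v := by
  refine Measure.le_iff.2 fun A hA => ?_
  rw [Measure.coe_nnreal_smul_apply, Measure.restrict_apply hA, gaussianReal_apply _ hv]
  change ENNReal.ofReal (gaussianPDFReal 0 v R) * volume (A ∩ Icc (-R) R) ≤ _
  calc ENNReal.ofReal (gaussianPDFReal 0 v R) * volume (A ∩ Icc (-R) R)
      = ∫⁻ _ in A ∩ Icc (-R) R, ENNReal.ofReal (gaussianPDFReal 0 v R) ∂volume := by
        rw [setLIntegral_const]
    _ ≤ ∫⁻ x in A ∩ Icc (-R) R, gaussianPDF 0 v x ∂volume := by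
        refine setLIntegral_mono' (hA.inter measurableSet_Icc) fun x hx => ?_
        exact ENNReal.ofReal_le_ofReal (gaussianPDFReal_ge_of_abs_le v (abs_le.2 hx.2))
    _ ≤ ∫⁻ x in A, gaussianPDF 0 v x ∂volume := lintegral_mono_set inter_subset_left

/-! ### The law of the skeleton -/

variable (m : ℕ)

/-- The variance of a dyadic increment is not zero. [folklore] -/
theorem nndist_dyad_succ_ne_zero (i : ℕ) : nndist (dyad m (i + 1)) (dyad m i) ≠ 0 := by
  intro h0
  have hne : (dyad m (i + 1) : ℝ) ≠ dyad m i := by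
    intro h
    have := coe_dyad_succ_sub m i
    rw [h, sub_self] at this
    exact absurd this (by positivity)
  exact hne (congrArg NNReal.toReal (nndist_eq_zero.1 h0))

/-- **The law of the dyadic skeleton of the canonical Brownian motion is the product of the
Gaussian laws of the increments.** [folklore] -/
theorem map_dyadicIncr_brownian_eq_pi :
    preWienerMeasure.map (fun (ω₁ : ℝ≥0 → ℝ) => dyadicIncr m fun u => brownian u ω₁) =
      Measure.pi fun i : Fin (2 ^ m) => gaussianReal 0 (nndist (dyad m (i + 1)) (dyad m i)) := by
  haveI := RandomPlanarGeometry.isProbabilityMeasure_preWienerMeasure'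
  have hB := RandomPlanarGeometry.isPreBrownianReal_brownian
  have hind : iIndepFun (fun (i : Fin (2 ^ m)) (ω₁ : ℝ≥0 → ℝ) =>
      brownian (dyad m (i + 1)) ω₁ - brownian (dyad m i) ω₁) preWienerMeasure := by
    have h := hB.hasIndepIncrements (2 ^ m) (fun j : Fin (2 ^ m + 1) => dyad m j)
      (fun j k hjk => dyad_mono m (by exact_mod_cast hjk))
    convert h using 3
    simp
  have hmeas : ∀ i : Fin (2 ^ m), AEMeasurable (fun (ω₁ : ℝ≥0 → ℝ) =>
      brownian (dyad m (i + 1)) ω₁ - brownian (dyad m i) ω₁) preWienerMeasure :=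
    fun i => ((measurable_brownian _).sub (measurable_brownian _)).aemeasurable
  have hpi := hind.map_fun_eq_pi_map hmeas
  change preWienerMeasure.map (fun (ω₁ : ℝ≥0 → ℝ) (i : Fin (2 ^ m)) =>
      brownian (dyad m (i + 1)) ω₁ - brownian (dyad m i) ω₁) = _
  rw [hpi]
  congr 1
  funext i
  have hlaw := (hB.hasLaw_sub (dyad m (i + 1)) (dyad m i)).map_eq
  exact hlaw

/-- **The law of the skeleton dominates Lebesgue measure on sup-norm balls**: for every `R` there
is `c > 0` with `law(Δ^m B)(A) ≥ c · Leb(A)` for all measurable `A` inside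
`{x | ∀ i, |x i| ≤ R}`. [folklore] -/
theorem exists_map_dyadicIncr_ge (R : ℝ) :
    ∃ c : ℝ≥0∞, 0 < c ∧ ∀ A : Set (Fin (2 ^ m) → ℝ), A ⊆ {x | ∀ i, |x i| ≤ R} → MeasurableSet A →
      c * volume A ≤ preWienerMeasure.map (fun (ω₁ : ℝ≥0 → ℝ) => dyadicIncr m fun u => brownian u ω₁) A := by
  -- one constant works for all increments (they have the same positive variance, but we do not
  -- need that): take the minimum over the finitely many factors
  set c₁ : Fin (2 ^ m) → ℝ≥0 := fun i =>
    (gaussianPDFReal 0 (nndist (dyad m (i + 1)) (dyad m i)) R).toNNReal with hc₁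
  have hc₁pos : ∀ i, 0 < c₁ i := fun i =>
    Real.toNNReal_pos.2 (gaussianPDFReal_pos _ _ _ (nndist_dyad_succ_ne_zero m i))
  -- a common lower bound `c₀ ≤ c₁ i`
  obtain ⟨c₀, hc₀pos, hc₀le⟩ : ∃ c₀ : ℝ≥0, 0 < c₀ ∧ ∀ i, c₀ ≤ c₁ i := by
    by_cases hne : (Finset.univ : Finset (Fin (2 ^ m))).Nonempty
    · obtain ⟨i₀, -, hi₀⟩ := Finset.exists_min_image Finset.univ c₁ hne
      exact ⟨c₁ i₀, hc₁pos i₀, fun i => hi₀ i (Finset.mem_univ i)⟩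
    · refine ⟨1, one_pos, fun i => ?_⟩
      exact absurd ⟨i, Finset.mem_univ i⟩ hne
  refine ⟨(c₀ : ℝ≥0∞) ^ (2 ^ m), ENNReal.pow_pos (by exact_mod_cast hc₀pos) _, fun A hA hAm => ?_⟩
  rw [map_dyadicIncr_brownian_eq_pi]
  -- compare the factors
  have hfac : ∀ i : Fin (2 ^ m), c₀ • (volume : Measure ℝ).restrict (Icc (-R) R) ≤
      gaussianReal 0 (nndist (dyad m (i + 1)) (dyad m i)) := by
    intro i
    refine le_trans (Measure.le_iff'.2 fun B => ?_)
      (gaussianReal_ge_smul_restrict (nndist_dyad_succ_ne_zero m i) R)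
    simp only [Measure.coe_nnreal_smul_apply]
    exact mul_le_mul' (by exact_mod_cast hc₀le i) le_rfl
  have hpi := Measure.pi_le_pi_fin (fun _ : Fin (2 ^ m) => c₀ • (volume : Measure ℝ).restrict (Icc (-R) R))
    (fun i => gaussianReal 0 (nndist (dyad m (i + 1)) (dyad m i))) hfac
  rw [Measure.pi_const_smul_restrict c₀ (Icc (-R) R)] at hpi
  have hAsub : A ⊆ Set.univ.pi fun _ : Fin (2 ^ m) => Icc (-R) R := fun x hx =>
    Set.mem_univ_pi.2 fun i => abs_le.1 (hA hx i)
  calc (c₀ : ℝ≥0∞) ^ (2 ^ m) * volume A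
      = ((c₀ : ℝ≥0∞) ^ (2 ^ m) • (volume : Measure (Fin (2 ^ m) → ℝ)).restrict
          (Set.univ.pi fun _ => Icc (-R) R)) A := by
        rw [Measure.smul_apply, Measure.restrict_apply hAm, smul_eq_mul,
          Set.inter_eq_self_of_subset_left hAsub]
    _ ≤ (Measure.pi fun i : Fin (2 ^ m) => gaussianReal 0 (nndist (dyad m (i + 1)) (dyad m i))) A :=
        Measure.le_iff'.1 hpi A

/-- **The law of the skeleton of the Brownian pair dominates Lebesgue measure on sup-norm
balls**: for every `R` there is `c > 0` with `law(Ξ)(A) ≥ c · Leb(A)` for all measurable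
`A ⊆ B̄(0, R)` in `(ℝ^{2^m})²`. [folklore] -/
theorem exists_wienerPair_map_pairSkel_ge (R : ℝ) :
    ∃ c : ℝ≥0∞, 0 < c ∧ ∀ A : Set (PairSkeleton m), A ⊆ Metric.closedBall 0 R → MeasurableSet A →
      c * volume A ≤ wienerPair.map (pairSkel m) A := by
  haveI := RandomPlanarGeometry.isProbabilityMeasure_preWienerMeasure'
  obtain ⟨c, hc, hle⟩ := exists_map_dyadicIncr_ge m R
  -- the single law dominates `c • Leb|_box`
  set box : Set (Fin (2 ^ m) → ℝ) := {x | ∀ i, |x i| ≤ R} with hbox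
  have hboxm : MeasurableSet box := by
    have : box = ⋂ i, {x : Fin (2 ^ m) → ℝ | |x i| ≤ R} := by ext x; simp [hbox]
    rw [this]
    exact MeasurableSet.iInter fun i => measurableSet_le (measurable_pi_apply i).abs measurable_const
  set law₁ := preWienerMeasure.map (fun (ω₁ : ℝ≥0 → ℝ) => dyadicIncr m fun u => brownian u ω₁) with hlaw₁
  have hdom : c • (volume : Measure (Fin (2 ^ m) → ℝ)).restrict box ≤ law₁ := by
    refine Measure.le_iff.2 fun A hA => ?_
    rw [Measure.smul_apply, Measure.restrict_apply hA, smul_eq_mul]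
    exact (hle (A ∩ box) (fun x hx => hx.2) (hA.inter hboxm)).trans (measure_mono inter_subset_left)
  -- the pair law is the product
  have hpair : wienerPair.map (pairSkel m) = law₁.prod law₁ := by
    rw [pairSkel_eq_prodMap, wienerPair, ← Measure.map_prod_map _ _ (measurable_dyadicIncr_brownian m)
      (measurable_dyadicIncr_brownian m)]
  haveI : IsProbabilityMeasure law₁ :=
    Measure.isProbabilityMeasure_map (measurable_dyadicIncr_brownian m).aemeasurable
  have hprod : (c • (volume : Measure (Fin (2 ^ m) → ℝ)).restrict box).prod
      (c • (volume : Measure (Fin (2 ^ m) → ℝ)).restrict box) ≤ law₁.prod law₁ :=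
    Measure.prod_mono hdom hdom
  refine ⟨c * c, ENNReal.mul_pos hc.ne' hc.ne', fun A hA hAm => ?_⟩
  rw [hpair]
  have hAsub : A ⊆ box ×ˢ box := by
    intro x hx
    have hx' : ‖x‖ ≤ R := by simpa [dist_zero_right] using hA hx
    rw [Prod.norm_def, max_le_iff] at hx'
    refine ⟨fun i => ?_, fun i => ?_⟩
    · exact (Real.norm_eq_abs _ ▸ norm_le_pi_norm x.1 i).trans hx'.1
    · exact (Real.norm_eq_abs _ ▸ norm_le_pi_norm x.2 i).trans hx'.2
  calc c * c * volume A = ((c • (volume : Measure (Fin (2 ^ m) → ℝ)).restrict box).prod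
        (c • (volume : Measure (Fin (2 ^ m) → ℝ)).restrict box)) A := by
        rw [Measure.prod_smul_left, Measure.prod_smul_right, Measure.smul_apply, Measure.smul_apply,
          Measure.prod_restrict, Measure.restrict_apply hAm, Set.inter_eq_self_of_subset_left hAsub,
          smul_eq_mul, smul_eq_mul, ← mul_assoc, Measure.volume_eq_prod]
    _ ≤ (law₁.prod law₁) A := Measure.le_iff'.1 hprod A

/-! ### The remainders are controlled by the paths on `[0, 1]` -/

/-- Tent coefficients lie in `[0, 1]`. [folklore] -/
theorem tentCoeff_mem_Icc (i : ℕ) (u : ℝ≥0) : tentCoeff m i u ∈ Icc (0 : ℝ) 1 := by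
  unfold tentCoeff
  rw [NNReal.coe_min, NNReal.coe_min]
  set a : ℝ := (dyad m i : ℝ) with ha
  set b : ℝ := (dyad m (i + 1) : ℝ) with hb
  set t : ℝ := (u : ℝ) with ht
  have hab : b - a = 1 / 2 ^ m := coe_dyad_succ_sub m i
  have hpos : (0 : ℝ) < 2 ^ m := by positivity
  have hab' : a ≤ b := by
    have : (0 : ℝ) < 1 / 2 ^ m := by positivity
    linarith
  have key1 : min a t ≤ min b t := min_le_min_right t hab'
  have key2 : min b t ≤ min a t + (b - a) := by
    rcases le_total a t with h | h
    · rw [min_eq_left h]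
      linarith [min_le_left b t]
    · rw [min_eq_right h]
      linarith [min_le_right b t]
  constructor
  · have : 0 ≤ min b t - min a t := by linarith
    positivity
  · calc (2 : ℝ) ^ m * (min b t - min a t) ≤ 2 ^ m * (b - a) := by
          refine mul_le_mul_of_nonneg_left ?_ hpos.le
          linarith
      _ = 1 := by rw [hab]; field_simp

/-- **The remainder is small when the path is small on `[0, 1]`**: if `|w u| ≤ ε` for all
`u ≤ 1` then `|R^m w(u)| ≤ (1 + 2·2ᵐ) ε` for all `u ≤ 1`. [folklore] -/
theorem abs_bridgeRem_le {w : ℝ≥0 → ℝ} {ε : ℝ} (hw : ∀ u : ℝ≥0, u ≤ 1 → |w u| ≤ ε) {u : ℝ≥0}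
    (hu : u ≤ 1) : |bridgeRem m w u| ≤ (1 + 2 * 2 ^ m) * ε := by
  have hε : 0 ≤ ε := (abs_nonneg _).trans (hw 0 zero_le_one)
  have hincr : ∀ i : Fin (2 ^ m), |dyadicIncr m w i| ≤ 2 * ε := by
    intro i
    unfold dyadicIncr
    have h1 : dyad m (i + 1) ≤ 1 := by
      have h := (KolmogorovChentsov.dyad_le_natCast_iff (m := m) (k := i + 1) (N := 1)).2
        (by have := i.isLt; omega)
      simpa using h
    have h0 : dyad m i ≤ 1 := by
      have h := (KolmogorovChentsov.dyad_le_natCast_iff (m := m) (k := i) (N := 1)).2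
        (by have := i.isLt; omega)
      simpa using h
    calc |w (dyad m (i + 1)) - w (dyad m i)| ≤ |w (dyad m (i + 1))| + |w (dyad m i)| := abs_sub _ _
      _ ≤ ε + ε := add_le_add (hw _ h1) (hw _ h0)
      _ = 2 * ε := by ring
  have hpl : |plInterp m (dyadicIncr m w) u| ≤ 2 ^ m * (2 * ε) := by
    unfold plInterp
    calc |∑ i, dyadicIncr m w i * tentCoeff m i u| ≤ ∑ i, |dyadicIncr m w i * tentCoeff m i u| :=
          Finset.abs_sum_le_sum_abs _ _
      _ ≤ ∑ _i : Fin (2 ^ m), 2 * ε := by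
          refine Finset.sum_le_sum fun i _ => ?_
          rw [abs_mul]
          have ht := tentCoeff_mem_Icc m i u
          rw [abs_of_nonneg ht.1]
          calc |dyadicIncr m w i| * tentCoeff m i u ≤ 2 * ε * 1 :=
                mul_le_mul (hincr i) ht.2 ht.1 (by positivity)
            _ = 2 * ε := mul_one _
      _ = 2 ^ m * (2 * ε) := by simp
  unfold bridgeRem
  calc |w u - plInterp m (dyadicIncr m w) u| ≤ |w u| + |plInterp m (dyadicIncr m w) u| := abs_sub _ _
    _ ≤ ε + 2 ^ m * (2 * ε) := add_le_add (hw u hu) hpl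
    _ = (1 + 2 * 2 ^ m) * ε := by ring

/-- **On the good event of `BrownianSupTail.lean` the remainders of the pair are small**:
`ω ∈ goodEvent ε 1 ⟹ |R^b_u(ω)| ≤ (1 + 2·2ᵐ) ε` for `u ≤ 1`, `b = 1, 2`. [folklore] -/
theorem abs_pairRem_le_of_mem_goodEvent {ε : ℝ} {ω : WienerPair} (hω : ω ∈ goodEvent ε 1) {u : ℝ≥0}
    (hu : u ≤ 1) :
    |(pairRem m ω).1 u| ≤ (1 + 2 * 2 ^ m) * ε ∧ |(pairRem m ω).2 u| ≤ (1 + 2 * 2 ^ m) * ε := by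
  have h1 : ∀ v : ℝ≥0, v ≤ 1 → |brownian v ω.1| ≤ ε := fun v hv => (abs_brownian_le_of_mem_goodEvent hω hv).1
  have h2 : ∀ v : ℝ≥0, v ≤ 1 → |brownian v ω.2| ≤ ε := fun v hv => (abs_brownian_le_of_mem_goodEvent hω hv).2
  exact ⟨abs_bridgeRem_le m (w := fun v => brownian v ω.1) h1 hu,
    abs_bridgeRem_le m (w := fun v => brownian v ω.2) h2 hu⟩

/-- **The good event has positive probability** (small balls of Wiener measure,
`BrownianSmallBall.lean`). [folklore] -/
theorem wienerPair_goodEvent_pos {ε : ℝ} (hε : 0 < ε) (h : ℝ≥0) : 0 < wienerPair (goodEvent ε h) := by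
  refine lt_of_lt_of_le (wienerPair_forall_abs_brownian_le_pos h hε) (measure_mono ?_)
  intro ω hω n k hk
  exact hω _ hk

end Literature.Probability.Process
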